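import Summits.ResolutionOfSingularities.ResolutionOfSingularities.Theorems.MarkedTransferCampaignW46WWalkCompare
import Summits.ResolutionOfSingularities.ResolutionOfSingularities.Theorems.MarkedTransferCampaignW46WWalkSubst
import Mathlib.RingTheory.MvPowerSeries.Substitution
import Literature.RingTheory.MvPowerSeries.MaximalIdealPow
import HarnessLib

/-!
# [OURS · L1 W4.6 rung (iii-2)] THE W-WALK: preliminaries for (ND) — first-order congruences in `K⟦t,y,z⟧` and binary forms in two
# independent linear forms of `t, y` (LEMMA D of the plan, part 1)

Cell `res-hironaka`, LADDER-RESOLUTION rung L (D-0089), slot W4.6 rung (iii); seat res-L1-s46-pv-5 (gen 6), plan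
`HOME/L/res-L1-s46-pv-5/W-WALK-PLAN.md` §1 (LEMMA D). Host route MarkedTransfer, `--supports stmt-ResolutionOfSingularities-16155 --as
helper`; kind definition (`linPart`, `linTY`).

WHAT (in `K⟦t,y,z⟧`, characteristic `p`). Two presentations of one germ: the INHERITED one `z^p + f` (`ord f ≥ p + 1`) of the walk, and
o1's BINARY one `u · (z₂^p + f₂)`, `f₂ = Σ_{i ≤ d₂} a_i x₂^{d₂−i} y₂^i`, some `a_i` a unit, `p + 1 ≤ d₂ ≤ 2p − 1`, `u` a unit, with
`t, y, z ∈ (x₂, y₂, z₂)` (the regime's `span {x₂, y₂, z₂} = 𝔪`, read in the completion). THEN (`ndz_of_presentation`):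
* every monomial `t^a y^b z^c` of `f` of degree `< d₂` with `c < p` has coefficient `0` (so `ord f ≤ d₂`, and `ord f = d₂` as soon
  as the top form of `f` has a monomial of `z`-degree `< p`, i.e. whenever the shade is `< p`);
* some `z`-FREE monomial of degree `d₂` occurs in `f`: **(ND)** `NDz d₂ f`.
Mechanism: comparing `t^p, y^p, z^p` gives `lin(z₂) = αZ` (`…Compare.coeff_mul_pow_p`), whence `u·z₂^p` has no monomial of degree
`< 2p` with `z`-exponent `< p` other than through `Z^p`; so those coefficients of `f` are the ones of `u·f₂ ≡ u(0)·Σ a_i(0)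
L_x^{d₂−i} L_y^i (mod 𝔪^{d₂+1})`, and the `z`-free part of this binary form in the independent linear forms `L_x|_{Z=0}, L_y|_{Z=0}`
is nonzero (inverse linear substitution).

HONEST FRAMING. OURS; nothing here is a statement of H. Hironaka's manuscript [Hironaka2017] and nothing of it is used. AI-written;
AI review is weaker than expert review. No `sorry`; axioms standard. [folklore]; [Hauser2010] §F for the role of the tangent cone.
-/

noncomputable section

set_option linter.dupNamespace false -- mandated namespace of this single-conjunct summit

open MvPowerSeries Finset IsLocalRing
open Literature.RingTheory.MvPowerSeries.Jets

namespace Summit.ResolutionOfSingularities.ResolutionOfSingularities.Theorems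

namespace CampaignW46

namespace WWalk

variable {K : Type*} [Field K]

local notation "R3" => MvPowerSeries (Option (Fin 2)) K
local notation "𝔪3" => IsLocalRing.maximalIdeal (MvPowerSeries (Option (Fin 2)) K)

/-! ## §1 `LowVanish` is membership in a power of the maximal ideal; small coefficient lemmas -/

/-- `LowVanish n f ↔ f ∈ 𝔪^n`. [folklore] -/
theorem lowVanish_iff_mem_pow {n : ℕ} {f : R3} : LowVanish n f ↔ f ∈ 𝔪3 ^ n := by
  rw [mem_maximalIdeal_pow_iff]; rfl

/-- A multiple of `z` has no `z`-free monomials. [folklore] -/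
theorem coeff_zfree_of_X_mul (h : R3) (a b : ℕ) : coeff (mk3 a b 0) (X none * h) = 0 := by
  classical
  rw [show (X none : R3) = monomial (Finsupp.single none 1) 1 by rw [← pow_one (X none : R3), X_pow_eq],
    coeff_monomial_mul, if_neg]
  intro hle
  have := hle none
  simp at this

/-- The linear part of a series. [folklore] -/
def linPart (x : R3) : R3 :=
  C (coeff (mk3 1 0 0) x) * X (some 0) + C (coeff (mk3 0 1 0) x) * X (some 1) + C (coeff (mk3 0 0 1) x) * X none

/-- `x − linPart x ∈ 𝔪²` for `x(0) = 0`. [folklore] -/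
theorem sub_linPart_mem (x : R3) (hx : constantCoeff x = 0) : x - linPart x ∈ 𝔪3 ^ 2 := by
  classical
  rw [← lowVanish_iff_mem_pow]
  intro e he
  rw [map_sub, linPart, map_add, map_add]
  simp only [coeff_C_mul, coeff_X]
  rcases Nat.lt_or_ge e.degree 1 with h0 | h1
  · have he0 : e = 0 := (Finsupp.degree_eq_zero_iff e).mp (by omega)
    subst he0
    have h1 : ¬ ((0 : Option (Fin 2) →₀ ℕ) = Finsupp.single (some 0) 1) := fun h => by
      have := congrArg (fun e => e (some 0)) h; simp at this
    have h2 : ¬ ((0 : Option (Fin 2) →₀ ℕ) = Finsupp.single (some 1) 1) := fun h => by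
      have := congrArg (fun e => e (some 1)) h; simp at this
    have h3 : ¬ ((0 : Option (Fin 2) →₀ ℕ) = Finsupp.single none 1) := fun h => by
      have := congrArg (fun e => e none) h; simp at this
    rw [if_neg h1, if_neg h2, if_neg h3, coeff_zero_eq_constantCoeff, hx]; ring
  · have hdeg1 : e.degree = 1 := by omega
    rw [degree_eq] at hdeg1
    have hcases : e = mk3 1 0 0 ∨ e = mk3 0 1 0 ∨ e = mk3 0 0 1 := by
      rw [← mk3_eta e, mk3_inj, mk3_inj, mk3_inj]; omega
    have hs0 : Finsupp.single (some 0) 1 = mk3 1 0 0 := by simp [mk3]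
    have hs1 : Finsupp.single (some 1) 1 = mk3 0 1 0 := by simp [mk3]
    have hsn : Finsupp.single none 1 = mk3 0 0 1 := by simp [mk3]
    rw [hs0, hs1, hsn]
    rcases hcases with h | h | h <;> rw [h] <;> simp [mk3_inj]

/-- `linPart x ∈ 𝔪`. [folklore] -/
theorem linPart_mem (x : R3) : linPart x ∈ 𝔪3 := by
  rw [mem_maximalIdeal_iff_constantCoeff_eq_zero, linPart]
  simp

/-- Powers agree to first order: `x^m − L^m ∈ 𝔪^{m+1}` when `x − L ∈ 𝔪²` and `L ∈ 𝔪`. [folklore] -/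
theorem pow_sub_pow_mem {x L : R3} (hxL : x - L ∈ 𝔪3 ^ 2) (hL : L ∈ 𝔪3) (m : ℕ) : x ^ m - L ^ m ∈ 𝔪3 ^ (m + 1) := by
  have hx : x ∈ 𝔪3 := by
    have : x = (x - L) + L := by ring
    rw [this]
    exact Ideal.add_mem _ (Ideal.pow_le_self (by norm_num) hxL) hL
  induction m with
  | zero => simp
  | succ m ih =>
    have : x ^ (m + 1) - L ^ (m + 1) = x * (x ^ m - L ^ m) + (x - L) * L ^ m := by ring
    rw [this, show m + 1 + 1 = 1 + (m + 1) by ring]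
    refine Ideal.add_mem _ ?_ ?_
    · rw [pow_add, pow_one]; exact Ideal.mul_mem_mul hx ih
    · rw [show 1 + (m + 1) = 2 + m by ring, pow_add]
      exact Ideal.mul_mem_mul hxL (Ideal.pow_mem_pow hL m)

/-- Products agree to first order. [folklore] -/
theorem mul_sub_mul_mem {A A' B B' : R3} {m n : ℕ} (hA : A - A' ∈ 𝔪3 ^ (m + 1)) (hB : B - B' ∈ 𝔪3 ^ (n + 1))
    (hA' : A ∈ 𝔪3 ^ m) (hB' : B' ∈ 𝔪3 ^ n) : A * B - A' * B' ∈ 𝔪3 ^ (m + n + 1) := by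
  have : A * B - A' * B' = A * (B - B') + (A - A') * B' := by ring
  rw [this]
  refine Ideal.add_mem _ ?_ ?_
  · rw [show m + n + 1 = m + (n + 1) by ring, pow_add]; exact Ideal.mul_mem_mul hA' hB
  · rw [show m + n + 1 = (m + 1) + n by ring, pow_add]; exact Ideal.mul_mem_mul hA hB'

/-! ## §2 Binary forms in two independent linear forms of `t, y` -/

/-- A linear form in `t, y`. [folklore] -/
def linTY (β γ : K) : R3 := C β * X (some 0) + C γ * X (some 1)

/-- Powers of a linear form in `t, y` are sums of `z`-free monomials of the right degree. [folklore] -/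
theorem linTY_pow_eq (β γ : K) (m : ℕ) :
    linTY β γ ^ m = ∑ j ∈ range (m + 1), monomial (mk3 j (m - j) 0) ((m.choose j : K) * β ^ j * γ ^ (m - j)) := by
  rw [linTY, add_pow]
  refine sum_congr rfl fun j hj => ?_
  rw [mul_pow, mul_pow, ← map_pow, ← map_pow,
    show (monomial (mk3 j (m - j) 0)) ((m.choose j : K) * β ^ j * γ ^ (m - j)) =
      C ((m.choose j : K) * β ^ j * γ ^ (m - j)) * X (some 0) ^ j * X (some 1) ^ (m - j) * X none ^ 0 by
      rw [C_mul_X_pow_eq_monomial], pow_zero, mul_one, map_mul, map_mul, map_natCast]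
  ring

/-- **Support of a product of powers of two linear forms in `t, y`**: only `z`-free monomials of degree `m + n`. [folklore] -/
theorem coeff_linTY_pow_mul_pow_eq_zero (β γ β' γ' : K) (m n : ℕ) {e : Option (Fin 2) →₀ ℕ}
    (he : ¬ (e none = 0 ∧ e.degree = m + n)) : coeff e (linTY β γ ^ m * linTY β' γ' ^ n) = 0 := by
  classical
  rw [linTY_pow_eq, linTY_pow_eq, sum_mul, map_sum]
  refine sum_eq_zero fun j hj => ?_
  rw [mul_sum, map_sum]
  refine sum_eq_zero fun j' hj' => ?_
  rw [monomial_mul_monomial, coeff_monomial, if_neg]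
  intro h
  apply he
  rw [mem_range] at hj hj'
  have h1 := congrArg (fun x => x none) h
  have h2 := congrArg Finsupp.degree h
  simp only [Finsupp.coe_add, Pi.add_apply, mk3_z, add_zero, map_add, degree_mk3] at h1 h2
  exact ⟨h1, by omega⟩

/-- **A nonzero binary form in two INDEPENDENT linear forms of `t, y` is nonzero**: if `βγ′ − γβ′ ≠ 0` and some `c_{i₀} ≠ 0`
(`i₀ ≤ n`) then `Σ_{i ≤ n} c_i ℓ^{n−i} ℓ′^{i}` has a nonzero `z`-free coefficient of degree `n` (inverse linear substitution).
[folklore] -/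
theorem exists_coeff_binaryForm_ne_zero {β γ β' γ' : K} (hdet : β * γ' - γ * β' ≠ 0) (c : ℕ → K) (n : ℕ) {i₀ : ℕ}
    (hi₀ : i₀ ≤ n) (hc : c i₀ ≠ 0) :
    ∃ a b, a + b = n ∧ coeff (mk3 a b 0) (∑ i ∈ range (n + 1), C (c i) * (linTY β γ ^ (n - i) * linTY β' γ' ^ i)) ≠ 0 := by
  classical
  set Q := ∑ i ∈ range (n + 1), C (c i) * (linTY β γ ^ (n - i) * linTY β' γ' ^ i) with hQ
  -- the inverse substitution `ψ`: `t ↦ (γ′ t − γ y)/det`, `y ↦ (−β′ t + β y)/det`, `z ↦ z`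
  set D := β * γ' - γ * β' with hD
  set ψ : Option (Fin 2) → R3 := fun o => Option.elim o (X none)
    ![C (γ' / D) * X (some 0) + C (-γ / D) * X (some 1), C (-β' / D) * X (some 0) + C (β / D) * X (some 1)] with hψ
  have hψS : HasSubst ψ := by
    refine hasSubst_of_constantCoeff_zero fun o => ?_
    rcases o with _ | ⟨i, hi⟩
    · exact constantCoeff_X _
    · interval_cases i
      · change constantCoeff (C (γ' / D) * X (some 0) + C (-γ / D) * X (some 1) : R3) = 0; simp
      · change constantCoeff (C (-β' / D) * X (some 0) + C (β / D) * X (some 1) : R3) = 0; simp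
  have hψ0 : ψ (some 0) = C (γ' / D) * X (some 0) + C (-γ / D) * X (some 1) := rfl
  have hψ1 : ψ (some 1) = C (-β' / D) * X (some 0) + C (β / D) * X (some 1) := rfl
  have k1 : β * (γ' / D) + γ * (-β' / D) = 1 := by field_simp; ring
  have k2 : β * (-γ / D) + γ * (β / D) = 0 := by field_simp; ring
  have k3 : β' * (γ' / D) + γ' * (-β' / D) = 0 := by field_simp; ring
  have k4 : β' * (-γ / D) + γ' * (β / D) = 1 := by field_simp; ring
  have hℓ : subst ψ (linTY β γ) = X (some 0) := by
    rw [linTY, subst_add hψS, subst_mul hψS, subst_mul hψS, subst_C, subst_C, subst_X hψS, subst_X hψS, hψ0, hψ1]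
    have e1 : (C β * (C (γ' / D) * X (some 0) + C (-γ / D) * X (some 1)) +
        C γ * (C (-β' / D) * X (some 0) + C (β / D) * X (some 1)) : R3) =
        C (β * (γ' / D) + γ * (-β' / D)) * X (some 0) + C (β * (-γ / D) + γ * (β / D)) * X (some 1) := by
      simp only [map_add, map_mul]; ring
    rw [e1, k1, k2, map_one, map_zero, one_mul, zero_mul, add_zero]
  have hℓ' : subst ψ (linTY β' γ') = X (some 1) := by
    rw [linTY, subst_add hψS, subst_mul hψS, subst_mul hψS, subst_C, subst_C, subst_X hψS, subst_X hψS, hψ0, hψ1]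
    have e1 : (C β' * (C (γ' / D) * X (some 0) + C (-γ / D) * X (some 1)) +
        C γ' * (C (-β' / D) * X (some 0) + C (β / D) * X (some 1)) : R3) =
        C (β' * (γ' / D) + γ' * (-β' / D)) * X (some 0) + C (β' * (-γ / D) + γ' * (β / D)) * X (some 1) := by
      simp only [map_add, map_mul]; ring
    rw [e1, k3, k4, map_one, map_zero, one_mul, zero_mul, zero_add]
  -- `ψ Q = Σ c_i t^{n-i} y^i`, whose coefficient at `t^{n-i₀} y^{i₀}` is `c_{i₀}`
  have hψQ : subst ψ Q = ∑ i ∈ range (n + 1), monomial (mk3 (n - i) i 0) (c i) := by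
    rw [hQ, ← coe_substAlgHom hψS, map_sum]
    refine sum_congr rfl fun i hi => ?_
    rw [map_mul, map_mul, map_pow, map_pow, coe_substAlgHom, subst_C, hℓ, hℓ', ← C_mul_X_pow_eq_monomial, pow_zero, mul_one,
      mul_assoc]
  have hne : subst ψ Q ≠ 0 := by
    intro h0
    have := congrArg (coeff (mk3 (n - i₀) i₀ 0)) h0
    rw [hψQ, map_sum, map_zero, sum_eq_single i₀] at this
    · rw [coeff_monomial, if_pos rfl] at this; exact hc this
    · intro i hi hne
      rw [coeff_monomial, if_neg]
      intro h; exact hne (mk3_inj.mp h).2.1.symm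
    · intro h; exact absurd (mem_range.mpr (by omega)) h
  have hQne : Q ≠ 0 := by
    intro h0; rw [h0, ← coe_substAlgHom hψS, map_zero] at hne; exact hne rfl
  -- a nonzero coefficient of `Q`, necessarily `z`-free of degree `n`
  obtain ⟨e, he⟩ : ∃ e, coeff e Q ≠ 0 := by
    by_contra h; push Not at h; exact hQne (MvPowerSeries.ext fun e => by rw [h e, map_zero])
  have hshape : e none = 0 ∧ e.degree = n := by
    by_contra hns
    apply he
    rw [hQ, map_sum]
    refine sum_eq_zero fun i hi => ?_
    rw [mem_range] at hi
    rw [coeff_C_mul, coeff_linTY_pow_mul_pow_eq_zero _ _ _ _ _ _ (by rw [show n - i + i = n by omega]; exact hns), mul_zero]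
  refine ⟨e (some 0), e (some 1), ?_, ?_⟩
  · have := hshape.2; rw [degree_eq, hshape.1] at this; omega
  · rw [show mk3 (e (some 0)) (e (some 1)) 0 = e by rw [← hshape.1]; exact mk3_eta e]
    exact he

end WWalk

end CampaignW46

end Summit.ResolutionOfSingularities.ResolutionOfSingularities.Theorems

end
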